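import Summits.CriticalPhenomena.CardyFormulaZ2.Theorems.HalfPlaneMarkDensityLaw.Negative.MarkEvents

/-!
# `HalfPlaneMarkDensityLaw` (crux stmt-CriticalPhenomena-5661), line `Sketch`:
# stub `stub_nearestLeft_of_window` — Positivity Q1 (deterministic counting inclusion)

On the window event `{L(B, c') ∈ [1, w]}` — some point of `[c', w] × {0}` is joined inside the lattice
half-plane `H = ℤ × ℕ` to the arc `B = [lo, hi] × {0}` (`hi < c'`) and no point of `[c', 0] × {0}` is —
let `k` be the LEAST abscissa in `[c', w]` with `(k,0)` joined to `B` inside `H`, and `t` the GREATEST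
abscissa in `[lo, k − 1]` with `(t,0)` joined to `(k,0)` inside `H` (it exists: the endpoint of the
crossing on `B` has abscissa `≤ hi < c' ≤ k`).  Then `1 ≤ k ≤ w` (abscissae in `[c', 0]` are excluded),
`lo ≤ t ≤ c' − 1` (if `t ≥ c'` then `(t,0)` is joined to `B` through `(k,0)`, contradicting the
minimality of `k`), and no `(s,0)` with `t < s < k` is joined to `(k,0)` inside `H` (maximality of `t`):
the nearest-left `H`-cluster neighbour of `(k,0)` on the boundary row lies in `[lo, c' − 1]`.

* `bpt_mem_rowIcc_iff`, `exists_eq_bpt_of_mem_rowIcc`: boundary-row bookkeeping.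
* `stub_nearestLeft_of_window`: `Int.exists_least_of_bdd` / `Int.exists_greatest_of_bdd`, with the tree's
  `openConnIn_comm` and `PlanarDuality.openConnIn_trans` (`Literature…PlanarDuality`).
-/

noncomputable section

namespace Summit.CriticalPhenomena.CardyFormulaZ2.Cruxes.HalfPlaneMarkDensityLaw.SketchLine

open Literature.Probability.Percolation Literature.Probability.LatticeModels
open MeasureTheory Filter Set SimpleGraph
open scoped Topology
open Summit.CriticalPhenomena.CardyFormulaZ2.Theorems.HalfPlaneMarkDensityLaw.Negative

namespace Positivity

/-- `(k,0) ∈ [k₀,k₁] × {0}` iff `k₀ ≤ k ≤ k₁`. [folklore] -/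
lemma bpt_mem_rowIcc_iff (k k₀ k₁ : ℤ) : bpt k ∈ rowIcc k₀ k₁ ↔ k₀ ≤ k ∧ k ≤ k₁ := by
  simp [rowIcc, bpt]

/-- A site of `[k₀,k₁] × {0}` is `(j, 0)` for some `k₀ ≤ j ≤ k₁`. [folklore] -/
lemma exists_eq_bpt_of_mem_rowIcc {v : Site 2} {k₀ k₁ : ℤ} (hv : v ∈ rowIcc k₀ k₁) :
    ∃ j : ℤ, v = bpt j ∧ k₀ ≤ j ∧ j ≤ k₁ := by
  simp only [rowIcc, mem_setOf_eq] at hv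
  exact ⟨v 0, (site_eq_bpt_iff v (v 0)).2 ⟨hv.1, rfl⟩, hv.2.1, hv.2.2⟩

/-- STUB Q1 (deterministic counting inclusion): on the window event `{L(B,c') ∈ [1,w]}` the leftmost point `k` of `[c',w]` joined to `B = [lo,hi]×{0}` has its nearest-left `H`-cluster neighbour in `[lo, c'−1]`. [folklore] -/
theorem stub_nearestLeft_of_window :
    ∀ (ω : BondConfig (Site 2)) (lo hi c' w : ℤ), hi < c' →
      ω ∈ openCrossing halfPlane (rowIcc lo hi) (rowIcc c' w) \ openCrossing halfPlane (rowIcc lo hi) (rowIcc c' 0) →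
      ∃ k : ℤ, 1 ≤ k ∧ k ≤ w ∧
        ω ∈ {ω : BondConfig (Site 2) | ∃ t : ℤ, lo ≤ t ∧ t ≤ c' - 1 ∧ ω ∈ openConnIn halfPlane (bpt (k)) (bpt t) ∧ ∀ s : ℤ, t < s → s < k → ω ∉ openConnIn halfPlane (bpt (k)) (bpt s)} := by
  intro ω lo hi c' w hc hω
  obtain ⟨hin, hout⟩ := hω
  obtain ⟨x, hx, y, hy, hxy⟩ := mem_openCrossing_iff.1 hin
  obtain ⟨j, rfl, hcj, hjw⟩ := exists_eq_bpt_of_mem_rowIcc hy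
  -- (1) the least abscissa `k ∈ [c', w]` with `(k,0)` joined inside `H` to `B`
  obtain ⟨k, ⟨hck, hkw, u, hu, huk⟩, hkmin⟩ := Int.exists_least_of_bdd
    (P := fun k ↦ c' ≤ k ∧ k ≤ w ∧ ∃ u ∈ rowIcc lo hi, ω ∈ openConnIn halfPlane u (bpt k))
    ⟨c', fun z hz ↦ hz.1⟩ ⟨j, hcj, hjw, x, hx, hxy⟩
  obtain ⟨i, rfl, hloi, hihi⟩ := exists_eq_bpt_of_mem_rowIcc hu
  -- `1 ≤ k`: no point of `[c', 0] × {0}` is joined to `B`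
  have hk1 : 1 ≤ k := by
    by_contra h
    exact hout (mem_openCrossing_iff.2
      ⟨bpt i, hu, bpt k, (bpt_mem_rowIcc_iff k c' 0).2 ⟨hck, by omega⟩, huk⟩)
  -- (2) the greatest abscissa `t ∈ [lo, k - 1]` with `(t,0)` joined inside `H` to `(k,0)`
  obtain ⟨t, ⟨hlot, htk, hkt⟩, htmax⟩ := Int.exists_greatest_of_bdd
    (P := fun t ↦ lo ≤ t ∧ t ≤ k - 1 ∧ ω ∈ openConnIn halfPlane (bpt k) (bpt t))
    ⟨k - 1, fun z hz ↦ hz.2.1⟩ ⟨i, hloi, by omega, by rw [openConnIn_comm]; exact huk⟩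
  refine ⟨k, hk1, hkw, t, hlot, ?_, hkt, fun s hts hsk hks ↦ ?_⟩
  · -- `t ≤ c' - 1`: otherwise `(t,0) ∈ [c', w] × {0}` is joined to `B` through `(k,0)`
    by_contra h
    have := hkmin t ⟨by omega, by omega, bpt i, hu, PlanarDuality.openConnIn_trans huk hkt⟩
    omega
  · -- maximality of `t`
    have := htmax s ⟨by omega, by omega, hks⟩
    omega

end Positivity

end Summit.CriticalPhenomena.CardyFormulaZ2.Cruxes.HalfPlaneMarkDensityLaw.SketchLine
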